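import Literature.Analysis.FluidPDE.NSUniqueness2DProofs
import Literature.Analysis.FluidPDE.NSUniqueness2DL4
import Literature.Analysis.FluidPDE.NSEnstrophyBalance2DGalerkin
import Literature.Analysis.FluidPDE.CheskidovAssemblyTools
import Mathlib.NumberTheory.ModularForms.EisensteinSeries.Summable
import HarnessLib

/-!
# Galerkin trajectories against a Leray–Hopf solution on `𝕋²`: the two-dimensional estimates

Analysis/FluidPDE support file (file 5 of the discharge of
`Literature.Analysis.FluidPDE.galerkin_tendsto_lerayHopf_torus2`, `NSEnstrophyBalance2DGalerkin`;
Foias–Manley–Rosa–Temam 2001, Ch. II Thm. 7.3). The energy inequality for `w = u - U`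
(`IsGalerkinTrajectory.difference_energy_le`, `NSGalerkinDifferenceEnergy`) has three error
terms; this file bounds them pointwise in time on the two-torus:

* `two_mul_abs_integral_inner_convect_le` — the Lions–Prodi absorption step
  `2|∫⟪w,(w·∇)U⟫| ≤ ν‖∇w‖₂² + (2√(CB) + CB/ν) ∫‖w‖²` when `‖∇U‖₂² ≤ B` (Hölder `4,4,2`,
  `Torus.lintegral_enorm_inner_convect_le`; Ladyzhenskaya's inequality with constant `C`,
  accepted `exists_ladyzhenskaya_const_memLp`; Young — Foias–Manley–Rosa–Temam 2001, (A.46e),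
  (A.47));
* `abs_integral_inner_sub_fourierTruncate_convect_le` — the Galerkin truncation error
  `|∫⟪v - P_N v,(V·∇)V⟫| ≤ (‖∇v‖₂² + Γ)/(4π√(N²+1))` when `∫‖(V·∇)V‖² ≤ Γ` (Cauchy–Schwarz and the
  spectral gap `Torus.integral_norm_sq_fourierTruncate_sub_le`), together with
  `integral_norm_convect_self_sq_le` (`∫‖(V·∇)V‖² ≤ (sup‖V‖²) ‖∇V‖₂²`) and the Agmon-type sup bound
  for Galerkin fields `norm_realTrigPoly_coeffExt_sq_le`,
  `‖U(x)‖² ≤ K₄ ∑ₖ (1 + |k|⁴)‖Û(k)‖²`, `K₄ = ∑_{ℤ²} (1+|k|⁴)⁻¹ < ∞`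
  (`summable_inv_one_add_freqNormSq_sq`, from Mathlib's `EisensteinSeries.summable_one_div_norm_rpow`),
  specialised to trajectories in `IsGalerkinTrajectory.norm_galerkinVelocity_sq_le` /
  `IsGalerkinTrajectory.integral_norm_convect_galerkinVelocity_sq_le` (`L²` norm plus palinstrophy);
* `integral_norm_sub_sq_le` (and the accepted Cauchy–Schwarz `abs_integral_inner_le_sqrt_mul_sqrt`
  of `CheskidovAssemblyTools`) — the triangle inequality in `L²` (for the force error `∫⟪f - P_N f, u⟫` and the bound on `∫‖w‖²`).

## References

* C. Foias, O. Manley, R. Rosa, R. Temam, *Navier–Stokes Equations and Turbulence*, CUP 2001,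
  Ch. II §7, Thm. 7.3; App. II.A (A.46)–(A.48).
* O. A. Ladyzhenskaya, *The Mathematical Theory of Viscous Incompressible Flow*, 2nd ed.,
  Gordon and Breach 1969, Ch. I §1 Lemma 1; Ch. VI §6 Thm. 2 (2-D uniqueness).
* J.-L. Lions, G. Prodi, C. R. Acad. Sci. Paris 248 (1959), 3519–3521.
-/

noncomputable section

open MeasureTheory TopologicalSpace Set Function Filter UnitAddTorus
open scoped InnerProductSpace RealInnerProductSpace ENNReal NNReal Topology

namespace Literature.Analysis.FluidPDE

open FunctionSpaces.Torus Torus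

/-! ### A lattice constant on `ℤ²` and the sup norm of Galerkin fields -/

section Lattice

variable {d : Type*} [Fintype d]

/-- The sup norm of an integer frequency is at most its Euclidean length: `‖k‖² ≤ |k|²`. [folklore] -/
theorem norm_sq_le_freqNormSq (k : d → ℤ) : ‖k‖ ^ 2 ≤ freqNormSq k := by
  have h : ‖k‖ ≤ Real.sqrt (freqNormSq k) := by
    refine (pi_norm_le_iff_of_nonneg (Real.sqrt_nonneg _)).2 fun i => ?_
    rw [Int.norm_eq_abs]
    exact abs_apply_le_sqrt_freqNormSq k i
  calc ‖k‖ ^ 2 ≤ Real.sqrt (freqNormSq k) ^ 2 := pow_le_pow_left₀ (norm_nonneg _) h 2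
    _ = freqNormSq k := Real.sq_sqrt (freqNormSq_nonneg k)

/-- **The lattice sum `∑_{k ∈ ℤ²} (1 + |k|⁴)⁻¹` converges** (comparison with `‖k‖⁻⁴`, summable on
`ℤ²` by `EisensteinSeries.summable_one_div_norm_rpow`). [folklore] -/
theorem summable_inv_one_add_freqNormSq_sq :
    Summable fun k : Fin 2 → ℤ => (1 + freqNormSq k ^ 2)⁻¹ := by
  set g : (Fin 2 → ℤ) → ℝ := fun k => ‖k‖ ^ (-4 : ℝ) + if k = 0 then 1 else 0 with hg
  have hg_sum : Summable g := by
    refine (EisensteinSeries.summable_one_div_norm_rpow (by norm_num : (2 : ℝ) < 4)).add ?_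
    refine summable_of_ne_finset_zero (s := {0}) fun k hk => ?_
    rw [Finset.mem_singleton] at hk
    rw [if_neg hk]
  refine Summable.of_nonneg_of_le (fun k => by have := freqNormSq_nonneg k; positivity) (fun k => ?_) hg_sum
  by_cases hk : k = 0
  · subst hk
    rw [hg]
    dsimp only
    rw [if_pos rfl, norm_zero, Real.zero_rpow (by norm_num : (-4 : ℝ) ≠ 0), zero_add, freqNormSq_zero]
    norm_num
  · rw [hg]
    dsimp only
    rw [if_neg hk, add_zero, Real.rpow_neg (norm_nonneg _),
      show (4 : ℝ) = ((4 : ℕ) : ℝ) by norm_num, Real.rpow_natCast]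
    have hpos : 0 < ‖k‖ := norm_pos_iff.2 hk
    refine inv_anti₀ (by positivity) ?_
    have h2 := norm_sq_le_freqNormSq k
    calc ‖k‖ ^ 4 = (‖k‖ ^ 2) ^ 2 := by ring
      _ ≤ freqNormSq k ^ 2 := pow_le_pow_left₀ (sq_nonneg _) h2 2
      _ ≤ 1 + freqNormSq k ^ 2 := le_add_of_nonneg_left zero_le_one

/-- **Sup norm of a Galerkin field on `𝕋²`** (Cauchy–Schwarz in the frequencies with the weight
`1 + |k|⁴`): `‖realTrigPoly S c̄ (x)‖² ≤ (∑_{ℤ²} (1+|k|⁴)⁻¹) ∑_{k∈S} (1 + |k|⁴) ‖c k‖²` — an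
Agmon-type bound by the `L²` norm and the palinstrophy (Foias–Manley–Rosa–Temam 2001, (A.48)). [folklore] -/
theorem norm_realTrigPoly_coeffExt_sq_le {S : Finset (Fin 2 → ℤ)} (c : ↥S → EuclideanSpace ℂ (Fin 2))
    (x : UnitAddTorus (Fin 2)) :
    ‖realTrigPoly S (coeffExt S c) x‖ ^ 2 ≤
      (∑' k : Fin 2 → ℤ, (1 + freqNormSq k ^ 2)⁻¹) *
        ∑ k : ↥S, (1 + freqNormSq (k : Fin 2 → ℤ) ^ 2) * ‖c k‖ ^ 2 := by
  have hq : ∀ k : Fin 2 → ℤ, 0 < 1 + freqNormSq k ^ 2 := fun k => by have := freqNormSq_nonneg k; positivity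
  have h1 : ‖realTrigPoly S (coeffExt S c) x‖ ≤ ∑ k : ↥S, ‖c k‖ := by
    refine (norm_realTrigPoly_apply_le S _ x).trans (le_of_eq ?_)
    exact sum_coeffExt (fun _ v => ‖v‖) c
  set a : ↥S → ℝ := fun k => Real.sqrt ((1 + freqNormSq (k : Fin 2 → ℤ) ^ 2)⁻¹) with ha
  set b : ↥S → ℝ := fun k => Real.sqrt (1 + freqNormSq (k : Fin 2 → ℤ) ^ 2) * ‖c k‖ with hb
  have hab : ∀ k : ↥S, a k * b k = ‖c k‖ := by
    intro k
    rw [ha, hb]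
    dsimp only
    rw [← mul_assoc, Real.sqrt_inv, inv_mul_cancel₀ (Real.sqrt_ne_zero'.2 (hq k)), one_mul]
  have hCS := Finset.sum_mul_sq_le_sq_mul_sq Finset.univ a b
  simp_rw [hab] at hCS
  have ha2 : ∑ k : ↥S, a k ^ 2 ≤ ∑' k : Fin 2 → ℤ, (1 + freqNormSq k ^ 2)⁻¹ := by
    have h : ∑ k : ↥S, a k ^ 2 = ∑ k ∈ S, (1 + freqNormSq k ^ 2)⁻¹ := by
      rw [← Finset.sum_coe_sort S]
      refine Finset.sum_congr rfl fun k _ => ?_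
      rw [ha]
      dsimp only
      rw [Real.sq_sqrt (inv_nonneg.2 (hq k).le)]
    rw [h]
    exact summable_inv_one_add_freqNormSq_sq.sum_le_tsum S fun k _ => inv_nonneg.2 (hq k).le
  have hb2 : ∑ k : ↥S, b k ^ 2 = ∑ k : ↥S, (1 + freqNormSq (k : Fin 2 → ℤ) ^ 2) * ‖c k‖ ^ 2 := by
    refine Finset.sum_congr rfl fun k _ => ?_
    rw [hb]
    dsimp only
    rw [mul_pow, Real.sq_sqrt (hq k).le]
  calc ‖realTrigPoly S (coeffExt S c) x‖ ^ 2 ≤ (∑ k : ↥S, ‖c k‖) ^ 2 :=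
        pow_le_pow_left₀ (norm_nonneg _) h1 2
    _ ≤ (∑ k : ↥S, a k ^ 2) * ∑ k : ↥S, b k ^ 2 := hCS
    _ ≤ (∑' k : Fin 2 → ℤ, (1 + freqNormSq k ^ 2)⁻¹) *
          ∑ k : ↥S, (1 + freqNormSq (k : Fin 2 → ℤ) ^ 2) * ‖c k‖ ^ 2 := by
        rw [hb2]
        exact mul_le_mul_of_nonneg_right ha2 (Finset.sum_nonneg fun k _ =>
          mul_nonneg (hq k).le (sq_nonneg _))

end Lattice

/-! ### Elementary `L²` bounds -/

section L2

variable {d : Type*} [Fintype d]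

/-- `∫ ‖a - b‖² ≤ 2∫‖a‖² + 2∫‖b‖²` for `a, b ∈ L²`. [folklore] -/
theorem integral_norm_sub_sq_le {a b : UnitAddTorus d → EuclideanSpace ℝ d}
    (ha : MemLp a 2 volume) (hb : MemLp b 2 volume) :
    ∫ x, ‖a x - b x‖ ^ 2 ≤ 2 * (∫ x, ‖a x‖ ^ 2) + 2 * ∫ x, ‖b x‖ ^ 2 := by
  have i1 := ha.integrable_norm_pow two_ne_zero
  have i2 := hb.integrable_norm_pow two_ne_zero
  calc ∫ x, ‖a x - b x‖ ^ 2 ≤ ∫ x, (2 * ‖a x‖ ^ 2 + 2 * ‖b x‖ ^ 2) := by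
        refine integral_mono_of_nonneg (ae_of_all _ fun x => sq_nonneg _)
          ((i1.const_mul 2).add (i2.const_mul 2)) (ae_of_all _ fun x => ?_)
        have h := norm_sub_le (a x) (b x)
        nlinarith [norm_nonneg (a x - b x), norm_nonneg (a x), norm_nonneg (b x), sq_nonneg (‖a x‖ - ‖b x‖)]
    _ = 2 * (∫ x, ‖a x‖ ^ 2) + 2 * ∫ x, ‖b x‖ ^ 2 := by
        rw [integral_add (i1.const_mul 2) (i2.const_mul 2), integral_const_mul, integral_const_mul]

end L2

/-! ### The self-convection and the two trilinear error terms -/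

section Bounds

variable {d : Type*} [Fintype d] [DecidableEq d]

/-- **The `L²` norm of the self-convection of a bounded smooth field**: if `‖V(x)‖² ≤ A` for all
`x` then `∫ ‖(V·∇)V‖² ≤ A ‖∇V‖₂²` (`‖(V·∇)V(x)‖ ≤ ‖V(x)‖ (∑ᵢ‖∂ᵢV(x)‖²)^{1/2}` and
`∫ ∑ᵢ‖∂ᵢV‖² = eGradNormSq V`). [folklore] -/
theorem integral_norm_convect_self_sq_le {V : UnitAddTorus d → EuclideanSpace ℝ d}
    (hV : FunctionSpaces.Torus.IsSmooth V) {A : ℝ} (hA : ∀ x, ‖V x‖ ^ 2 ≤ A) :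
    ∫ x, ‖FunctionSpaces.Torus.convect V V x‖ ^ 2 ≤ A * (eGradNormSq V).toReal := by
  have hA0 : 0 ≤ A := (sq_nonneg _).trans (hA 0)
  have hV1 : FunctionSpaces.Torus.IsContDiff 1 V := hV.isContDiff (by simp)
  have hpt : ∀ x, ‖FunctionSpaces.Torus.convect V V x‖ ^ 2 ≤ A * ∑ i, ‖FunctionSpaces.Torus.partialDeriv i V x‖ ^ 2 := by
    intro x
    have h := norm_convect_le_mul_sqrt hV1 V x
    have hs : 0 ≤ ∑ i, ‖FunctionSpaces.Torus.partialDeriv i V x‖ ^ 2 := Finset.sum_nonneg fun i _ => sq_nonneg _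
    calc ‖FunctionSpaces.Torus.convect V V x‖ ^ 2
        ≤ (‖V x‖ * Real.sqrt (∑ i, ‖FunctionSpaces.Torus.partialDeriv i V x‖ ^ 2)) ^ 2 :=
          pow_le_pow_left₀ (norm_nonneg _) h 2
      _ = ‖V x‖ ^ 2 * ∑ i, ‖FunctionSpaces.Torus.partialDeriv i V x‖ ^ 2 := by
          rw [mul_pow, Real.sq_sqrt hs]
      _ ≤ A * ∑ i, ‖FunctionSpaces.Torus.partialDeriv i V x‖ ^ 2 := mul_le_mul_of_nonneg_right (hA x) hs
  have hint : Integrable (fun x => ∑ i, ‖FunctionSpaces.Torus.partialDeriv i V x‖ ^ 2) volume :=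
    integrable_finsetSum _ fun i _ => ((hV.partialDeriv i).memLp 2).integrable_norm_pow two_ne_zero
  calc ∫ x, ‖FunctionSpaces.Torus.convect V V x‖ ^ 2
      ≤ ∫ x, A * ∑ i, ‖FunctionSpaces.Torus.partialDeriv i V x‖ ^ 2 :=
        integral_mono_of_nonneg (ae_of_all _ fun x => sq_nonneg _) (hint.const_mul A) (ae_of_all _ hpt)
    _ = A * (eGradNormSq V).toReal := by
        rw [integral_const_mul, ← gradNormSq_eq_toReal_eGradNormSq_holds hV]
        rfl

end Bounds

section Bounds2

/-- Local notation for the flat unit two-torus. -/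
local notation "𝕋²" => UnitAddTorus (Fin 2)
/-- Local notation for `ℝ²`. -/
local notation "ℝ²" => EuclideanSpace ℝ (Fin 2)

/-- `√(E Γ) ≤ (E + Γ)/2` for nonnegative reals. [folklore] -/
theorem Real.sqrt_mul_le_add_div_two {E Γ : ℝ} (hE : 0 ≤ E) (hΓ : 0 ≤ Γ) :
    Real.sqrt (E * Γ) ≤ (E + Γ) / 2 := by
  rw [show E * Γ = Real.sqrt E * Real.sqrt Γ * (Real.sqrt E * Real.sqrt Γ) by
    rw [mul_mul_mul_comm, Real.mul_self_sqrt hE, Real.mul_self_sqrt hΓ]]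
  rw [Real.sqrt_mul_self (by positivity)]
  nlinarith [sq_nonneg (Real.sqrt E - Real.sqrt Γ), Real.sq_sqrt hE, Real.sq_sqrt hΓ]

/-- **The truncation-error trilinear term** (pointwise in time): for `v ∈ L²(𝕋²)` of finite
dissipation, a smooth `V` with `∫ ‖(V·∇)V‖² ≤ Γ`, and the Fourier truncation `P_N`,
`|∫ ⟪v - P_N v, (V·∇)V⟫| ≤ (‖∇v‖₂² + Γ) / (4π √(N² + 1))`
(Cauchy–Schwarz, the spectral gap `∫‖v - P_N v‖² ≤ ‖∇v‖₂²/(4π²(N²+1))`,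
`Torus.integral_norm_sq_fourierTruncate_sub_le`, and `√(ab) ≤ (a+b)/2`). [folklore] -/
theorem abs_integral_inner_sub_fourierTruncate_convect_le {v : 𝕋² → ℝ²} (hv : MemLp v 2 volume)
    (hfin : eGradNormSq v ≠ ⊤) {V : 𝕋² → ℝ²} (hV : FunctionSpaces.Torus.IsSmooth V) {Γ : ℝ}
    (hΓ0 : 0 ≤ Γ) (hΓ : ∫ x, ‖FunctionSpaces.Torus.convect V V x‖ ^ 2 ≤ Γ) (N : ℕ) :
    |∫ x, ⟪v x - fourierTruncate N v x, FunctionSpaces.Torus.convect V V x⟫| ≤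
      ((eGradNormSq v).toReal + Γ) / (4 * Real.pi * Real.sqrt ((N : ℝ) ^ 2 + 1)) := by
  set E : ℝ := (eGradNormSq v).toReal with hE
  have hE0 : 0 ≤ E := ENNReal.toReal_nonneg
  set c : ℝ := 4 * Real.pi ^ 2 * ((N : ℝ) ^ 2 + 1) with hc
  have hc0 : 0 < c := by positivity
  have hsqc : Real.sqrt c = 2 * Real.pi * Real.sqrt ((N : ℝ) ^ 2 + 1) := by
    rw [hc, Real.sqrt_mul (by positivity), show 4 * Real.pi ^ 2 = (2 * Real.pi) ^ 2 by ring,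
      Real.sqrt_sq (by positivity)]
  -- the truncation error in `L²`
  have hr : MemLp (fun x => v x - fourierTruncate N v x) 2 volume := hv.sub (memLp_fourierTruncate N v 2)
  have htail : tailGradNormSq N v ≠ ⊤ := ne_top_of_le_ne_top hfin (tailGradNormSq_le N v)
  have hr2 : ∫ x, ‖v x - fourierTruncate N v x‖ ^ 2 ≤ E / c := by
    have h := Torus.integral_norm_sq_fourierTruncate_sub_le hv N htail
    have h2 : (tailGradNormSq N v).toReal ≤ E := ENNReal.toReal_mono hfin (tailGradNormSq_le N v)
    calc ∫ x, ‖v x - fourierTruncate N v x‖ ^ 2 = ∫ x, ‖fourierTruncate N v x - v x‖ ^ 2 := by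
          simp_rw [norm_sub_rev]
      _ ≤ (tailGradNormSq N v).toReal / (4 * Real.pi ^ 2 * ((N : ℝ) ^ 2 + 1)) := h
      _ ≤ E / c := by rw [hc]; gcongr
  -- Cauchy–Schwarz
  have hCS := abs_integral_inner_le_sqrt_mul_sqrt hr ((hV.convect hV).memLp 2)
  have hg : Real.sqrt (∫ x, ‖FunctionSpaces.Torus.convect V V x‖ ^ 2) ≤ Real.sqrt Γ := Real.sqrt_le_sqrt hΓ
  have hrs : Real.sqrt (∫ x, ‖v x - fourierTruncate N v x‖ ^ 2) ≤ Real.sqrt (E / c) := Real.sqrt_le_sqrt hr2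
  calc |∫ x, ⟪v x - fourierTruncate N v x, FunctionSpaces.Torus.convect V V x⟫|
      ≤ Real.sqrt (E / c) * Real.sqrt Γ :=
        hCS.trans (mul_le_mul hrs hg (Real.sqrt_nonneg _) (Real.sqrt_nonneg _))
    _ = Real.sqrt (E * Γ) / Real.sqrt c := by
        rw [Real.sqrt_div hE0, Real.sqrt_mul hE0, div_mul_eq_mul_div]
    _ ≤ ((E + Γ) / 2) / Real.sqrt c :=
        div_le_div_of_nonneg_right (Real.sqrt_mul_le_add_div_two hE0 hΓ0) (Real.sqrt_nonneg _)
    _ = (E + Γ) / (4 * Real.pi * Real.sqrt ((N : ℝ) ^ 2 + 1)) := by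
        rw [hsqc]; ring

/-- **The trilinear term `b(w, U, w)` absorbed by the dissipation** (pointwise in time, the
Lions–Prodi step): on `𝕋²`, for `w ∈ L²` with `‖∇w‖₂² = D < ∞`, a smooth `V` with `‖∇V‖₂² ≤ B`,
a Ladyzhenskaya constant `C` (`∫|v|⁴ ≤ C |v|²₂(|v|₂² + ‖∇v‖₂²)`, accepted
`exists_ladyzhenskaya_const_memLp`) and `ν > 0`,
`2 |∫ ⟪w, (w·∇)V⟫| ≤ ν D + (2√(CB) + CB/ν) ∫‖w‖²`
(Hölder `4,4,2`, `Torus.lintegral_enorm_inner_convect_le`, Ladyzhenskaya, and Young;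
Foias–Manley–Rosa–Temam 2001, (A.46e)/(A.47)). [cite: FoiasManleyRosaTemam2001, App. II.A (A.46)–(A.47)] -/
theorem two_mul_abs_integral_inner_convect_le {w : 𝕋² → ℝ²} (hw : MemLp w 2 volume) {D : ℝ}
    (hD0 : 0 ≤ D) (hD : eGradNormSq w = ENNReal.ofReal D) {V : 𝕋² → ℝ²}
    (hV : FunctionSpaces.Torus.IsSmooth V) {B : ℝ} (hB0 : 0 ≤ B) (hB : eGradNormSq V ≤ ENNReal.ofReal B)
    {C : ℝ≥0∞} (hC : C ≠ ⊤)
    (hL : ∀ v : 𝕋² → ℝ², MemLp v 2 volume →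
      ∫⁻ x, ‖v x‖ₑ ^ 4 ≤ C * ((∫⁻ x, ‖v x‖ₑ ^ 2) * ((∫⁻ x, ‖v x‖ₑ ^ 2) + eGradNormSq v)))
    {ν : ℝ} (hν : 0 < ν) :
    2 * |∫ x, ⟪w x, FunctionSpaces.Torus.convect w V x⟫| ≤
      ν * D + (2 * Real.sqrt (C.toReal * B) + C.toReal * B / ν) * ∫ x, ‖w x‖ ^ 2 := by
  set W : ℝ := ∫ x, ‖w x‖ ^ 2 with hWdef
  have hW0 : 0 ≤ W := integral_nonneg fun x => sq_nonneg _
  set C' : ℝ := C.toReal with hC'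
  have hC'0 : 0 ≤ C' := ENNReal.toReal_nonneg
  have hCC : C = ENNReal.ofReal C' := (ENNReal.ofReal_toReal hC).symm
  have hW : ∫⁻ x, ‖w x‖ₑ ^ 2 = ENNReal.ofReal W := lintegral_enorm_sq_eq_ofReal hw
  set X : ℝ := C' * (W * (W + D)) with hX
  have hX0 : 0 ≤ X := by positivity
  -- step 1: the `ℝ≥0∞` bound
  have hL4 : ∫⁻ x, ‖w x‖ₑ ^ 4 ≤ ENNReal.ofReal X := by
    refine (hL w hw).trans (le_of_eq ?_)
    rw [hW, hD, hCC, hX, ← ENNReal.ofReal_add hW0 hD0, ← ENNReal.ofReal_mul hW0, ← ENNReal.ofReal_mul hC'0]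
  have h1 : ‖∫ x, ⟪w x, FunctionSpaces.Torus.convect w V x⟫‖ₑ ≤
      ENNReal.ofReal (Real.sqrt X * Real.sqrt B) := by
    refine (enorm_integral_le_lintegral_enorm _).trans ?_
    refine (lintegral_enorm_inner_convect_le hw.1 hw.1 hV).trans ?_
    have h4 : (∫⁻ x, ‖w x‖ₑ ^ 4) ^ (1 / 4 : ℝ) * (∫⁻ x, ‖w x‖ₑ ^ 4) ^ (1 / 4 : ℝ) =
        (∫⁻ x, ‖w x‖ₑ ^ 4) ^ (1 / 2 : ℝ) := by
      rw [← ENNReal.rpow_add_of_nonneg _ _ (by norm_num) (by norm_num)]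
      norm_num
    rw [h4, ENNReal.ofReal_mul (Real.sqrt_nonneg _), Real.sqrt_eq_rpow, Real.sqrt_eq_rpow,
      ← ENNReal.ofReal_rpow_of_nonneg hX0 (by norm_num), ← ENNReal.ofReal_rpow_of_nonneg hB0 (by norm_num)]
    exact mul_le_mul' (ENNReal.rpow_le_rpow hL4 (by norm_num)) (ENNReal.rpow_le_rpow hB (by norm_num))
  have h2 : |∫ x, ⟪w x, FunctionSpaces.Torus.convect w V x⟫| ≤ Real.sqrt X * Real.sqrt B := by
    rw [← Real.norm_eq_abs, ← ENNReal.ofReal_le_ofReal_iff (by positivity), ofReal_norm]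
    exact h1
  -- step 2: real algebra
  have hXB : Real.sqrt X * Real.sqrt B = Real.sqrt (C' * B) * Real.sqrt (W * (W + D)) := by
    rw [← Real.sqrt_mul hX0, ← Real.sqrt_mul (by positivity), hX]
    ring_nf
  have h3 : Real.sqrt (W * (W + D)) ≤ W + Real.sqrt W * Real.sqrt D := by
    have hsq : W * (W + D) ≤ (W + Real.sqrt W * Real.sqrt D) ^ 2 := by
      nlinarith [Real.sq_sqrt hW0, Real.sq_sqrt hD0, Real.sqrt_nonneg W, Real.sqrt_nonneg D,
        mul_nonneg (mul_nonneg hW0 (Real.sqrt_nonneg W)) (Real.sqrt_nonneg D)]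
    calc Real.sqrt (W * (W + D)) ≤ Real.sqrt ((W + Real.sqrt W * Real.sqrt D) ^ 2) := Real.sqrt_le_sqrt hsq
      _ = W + Real.sqrt W * Real.sqrt D := Real.sqrt_sq (by positivity)
  have h4 : 2 * Real.sqrt (C' * B) * (Real.sqrt W * Real.sqrt D) ≤ ν * D + C' * B / ν * W := by
    set p : ℝ := Real.sqrt (C' * B) * Real.sqrt W with hp
    set q : ℝ := Real.sqrt D with hq
    have hp2 : p ^ 2 = C' * B * W := by
      rw [hp, mul_pow, Real.sq_sqrt (by positivity), Real.sq_sqrt hW0]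
    have hq2 : q ^ 2 = D := Real.sq_sqrt hD0
    have key : 2 * p * q ≤ ν * q ^ 2 + p ^ 2 / ν := by
      rw [div_eq_mul_inv]
      have hν' : 0 < ν⁻¹ := inv_pos.2 hν
      nlinarith [sq_nonneg (ν * q - p), mul_pos hν hν', mul_inv_cancel₀ hν.ne', sq_nonneg p, sq_nonneg q]
    calc 2 * Real.sqrt (C' * B) * (Real.sqrt W * Real.sqrt D) = 2 * p * q := by rw [hp, hq]; ring
      _ ≤ ν * q ^ 2 + p ^ 2 / ν := key
      _ = ν * D + C' * B / ν * W := by rw [hp2, hq2]; ring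
  have hsC : 0 ≤ Real.sqrt (C' * B) := Real.sqrt_nonneg _
  calc 2 * |∫ x, ⟪w x, FunctionSpaces.Torus.convect w V x⟫|
      ≤ 2 * (Real.sqrt (C' * B) * Real.sqrt (W * (W + D))) := by rw [← hXB]; linarith
    _ ≤ 2 * (Real.sqrt (C' * B) * (W + Real.sqrt W * Real.sqrt D)) := by gcongr
    _ = 2 * Real.sqrt (C' * B) * W + 2 * Real.sqrt (C' * B) * (Real.sqrt W * Real.sqrt D) := by ring
    _ ≤ 2 * Real.sqrt (C' * B) * W + (ν * D + C' * B / ν * W) := by linarith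
    _ = ν * D + (2 * Real.sqrt (C' * B) + C' * B / ν) * W := by ring

end Bounds2

/-! ### The bounds along a Galerkin trajectory on `𝕋²` -/

section Trajectory

/-- Local notation for the flat unit two-torus. -/
local notation "𝕋²" => UnitAddTorus (Fin 2)
/-- Local notation for `ℝ²`. -/
local notation "ℝ²" => EuclideanSpace ℝ (Fin 2)
/-- Local notation for `ℂ²`. -/
local notation "ℂ²" => EuclideanSpace ℂ (Fin 2)

variable {ν : ℝ} {S : Finset (Fin 2 → ℤ)} {f u₀ : 𝕋² → ℝ²} {α : ℝ → ↥S → ℂ²}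

/-- **Sup norm of a Galerkin velocity on `𝕋²` by energy and palinstrophy**:
`‖U(s,x)‖² ≤ K₄ (∫‖U(s)‖² + ‖ΔU(s)‖₂²/(16π⁴))`, `K₄ = ∑_{ℤ²} (1+|k|⁴)⁻¹`
(`norm_realTrigPoly_coeffExt_sq_le` and the coefficient formulas for the energy and the
palinstrophy of a trajectory). [folklore] -/
theorem IsGalerkinTrajectory.norm_galerkinVelocity_sq_le (h : IsGalerkinTrajectory ν S f u₀ α)
    (s : ℝ) (x : 𝕋²) :
    ‖galerkinVelocity S α s x‖ ^ 2 ≤ (∑' k : Fin 2 → ℤ, (1 + freqNormSq k ^ 2)⁻¹) *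
      ((∫ y, ‖galerkinVelocity S α s y‖ ^ 2) +
        (eLaplacianNormSq (galerkinVelocity S α s)).toReal / (16 * Real.pi ^ 4)) := by
  have h1 := norm_realTrigPoly_coeffExt_sq_le (α s) x
  refine h1.trans (le_of_eq ?_)
  congr 1
  rw [← h.sum_norm_sq_eq_integral s, h.toReal_eLaplacianNormSq_eq s,
    mul_div_cancel_left₀ _ (by positivity : (16 * Real.pi ^ 4 : ℝ) ≠ 0), ← Finset.sum_add_distrib]
  exact Finset.sum_congr rfl fun k _ => by ring

/-- **The `L²` norm of the self-convection of a Galerkin velocity on `𝕋²`**: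
`∫ ‖(U·∇)U(s)‖² ≤ K₄ (∫‖U(s)‖² + ‖ΔU(s)‖₂²/(16π⁴)) ‖∇U(s)‖₂²`. [folklore] -/
theorem IsGalerkinTrajectory.integral_norm_convect_galerkinVelocity_sq_le (h : IsGalerkinTrajectory ν S f u₀ α)
    (s : ℝ) :
    ∫ x, ‖FunctionSpaces.Torus.convect (galerkinVelocity S α s) (galerkinVelocity S α s) x‖ ^ 2 ≤
      (∑' k : Fin 2 → ℤ, (1 + freqNormSq k ^ 2)⁻¹) *
        ((∫ y, ‖galerkinVelocity S α s y‖ ^ 2) +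
          (eLaplacianNormSq (galerkinVelocity S α s)).toReal / (16 * Real.pi ^ 4)) *
        (eGradNormSq (galerkinVelocity S α s)).toReal :=
  integral_norm_convect_self_sq_le (h.isSmooth s) (h.norm_galerkinVelocity_sq_le s)

end Trajectory

end Literature.Analysis.FluidPDE
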